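import Summits.QuantumFields.YangMills.Theorems.PoincareLipschitzRegaugedTowerStepMass
import Summits.QuantumFields.YangMills.Theorems.PoincareLipschitzRegaugedTowerInduction
import Summits.QuantumFields.YangMills.Theorems.PoincareLipschitzOrbitMinimiserLevel
import HarnessLib

/-!
# Crux stmt-QuantumFields-19936 `UnitScaleTilt.HistoryTailL`, K2 at depth (route crux `PoincareLipschitz.BlockLipschitzL`, stmt-QuantumFields-23533),
# F6 of the K2 supplier plan of record (card v1.27 (c) ∕ v1.30 (c)), file F6-IND — THE RE-GAUGED, RE-MINIMISED NONLINEAR TOWER, k-UNIFORM,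
# WITH THE PER-LEVEL WALK MASSES DISPLAYED: `∃ h orbit-minimising`, `‖Y(Ū^{(k)}U, (Ū^{(k)}U')^h)‖_{ℓ²(S_k)} ≤ 2·ρ^k·‖Y(U, U'^{h₀})‖_{ℓ²(S_0)}`,
# `ρ = √((L^d)⁻¹L²)`, under NO smallness of the `ℓ²` datum `X`

Cell `ym3-torus` (YM ladder rung R3 = continuum SU(2) Yang–Mills on the three-torus — a RUNG, NOT the Clay problem: not d = 4, not infinite
volume, not a mass gap); width seat `ym-ust-19936-w2` g11, F6 pen (LEAD `ym-ust-19936-w1` g7, 2026-08-29T02:02:59Z (4)).  Helper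
`--supports stmt-QuantumFields-19936`; THEOREMS ONLY (0 `def`, 0 `sorry`); `Params`-generic, gauge group `SU(2)`, average of record `ℰ = expMeanLogSU`.
Nothing here proves `hStab`, h⋆ on the annulus, a stub, `BlockLipschitzL`, `HistoryTailL` or a summit statement.

WHY.  The F5 tower ✓`PoincareLipschitzRegaugedTowerInduction.exists_regauged_tower` (p686171) closes «average stability modulo gauge» only in the
small-data regime `144·C₁X ≤ 1`, because its level step bounds the two-block walk masses `m_i(c) = (d+2)L·Σ_{N(c)}‖Y_i‖` by Cauchy–Schwarz against the
GLOBAL `ℓ²` mass (`≤ C₁·M_i ≤ 2C₁X`).  The LEAD's re-read step ✓`PoincareLipschitzRegaugedTowerStepMass.exists_regauge_sum_normSq_le_of_mass` (p688053)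
takes the walk-mass bound `ms_i` as a HYPOTHESIS.  This file re-runs the induction over that step with (a) the per-level masses `ms_i` and their guards
DISPLAYED, (b) ONE displayed per-level MASS ROW `hMass` — «every box-`ℓ²`-ORBIT-MINIMISING level-`i` gauge copy `W = (Ū^iU')^h` of the averaged second
field with `Σ_{S_i}‖pertVar (Ū^iU) W‖² ≤ (2ρ^iX)²` has walk masses `≤ ms_i` on `S_{i+1}`» — the socket the covariant mean-value road fills
(★w5 COV-BRIDGE `normSq_le_of_cov_curl_div_plaq_torus` + COV-CURL-OF-RATIO + the divB-bridge at an orbit minimiser, ★w3 ALIGN's a-priori chart,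
px7 COV-ONE-FORM-MV), and (c) a RE-MINIMISATION at every level (✓`PoincareLipschitzOrbitMinLevel.exists_orbitMinimiser_level`, F2): the step's
re-gauged copy `(Ū^{i+1}U')^{g·(h_i∘emb)}` is replaced by a box-`ℓ²`-orbit minimiser `h_{i+1}` on `S_{i+1}` — the `ℓ²` mass only decreases, the
`α`-windows read the background `Ū^{i+1}U` only, and orbit-minimality (in ✓`reTr_oneSite_le_of_orbitMin_level`'s `hmin` currency, `box := (· ∈ S_{i+1})`)
is what makes the covariant divergence of `Y_{i+1}` small (Kirchhoff with cubic defect), i.e. what makes `hMass` inhabitable.  The `ℓ²` datum `X`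
is FREE: no `144·C₁X ≤ 1`, no `6C₁X + α_i < δ₂` — those are replaced by `72·ms_i ≤ 1`, `3·ms_i + α_i < δ₂` and `(κ/ρ)·Σ_{i<k}(159α_i + 520·ms_i) ≤ 1/2`.

THE INDUCTION ([Balaban1985Averaging] §3 (156)–(163), `ℓ²` currency, re-minimised).  Claim `P(i)`: `∃ h_i : GaugeTransf P i SU(2)`, `(Ū^iU')^{h_i}`
box-`ℓ²`-orbit-minimising on `S_i` w.r.t. `Ū^iU`, and `Σ_{S_i}‖pertVar (Ū^iU) ((Ū^iU')^{h_i})‖² ≤ (X·ρ^i·E_i)²`, `E_i = exp((κ/ρ)Σ_{i'<i} q_{i'})`,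
`q_i = 159α_i + 520·ms_i` (`E_i ≤ 2`).  `P(0)`: the level-`0` minimiser (mass `≤` that of `U'` itself `≤ X²`).  `P(i) ⇒ P(i+1)`: `hMass` at `h_i` gives the
walk masses; p688053 at `V := Ū^iU`, `W := (Ū^iU')^{h_i}`, `M := Xρ^iE_i` gives `g` with `ℓ²(S_{i+1})`-mass `≤ (ρ + κq_i)·M ≤ Xρ^{i+1}E_{i+1}` (`1 + x ≤ eˣ`);
covariance ✓`BlockAveraging.avgFun_covariant` + `(V^v)^u = V^{uv}` identify the re-gauged average with `(Ū^{i+1}U')^{g·(h_i∘emb)}`; the level-`(i+1)`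
minimiser `h_{i+1}` does at least as well and is orbit-minimising.

WHAT IS PROVED (ns `…Theorems.PoincareLipschitzRegaugedTowerInductionMass`).
* §1 `sum_normSq_pertVar_eq_boxDistSq` (currency: `Σ_{b∈S}‖pertVar V W b‖² = Σ_b 𝟙_S(b)·dist1(V_b W_b⁻¹)²`), ★`exists_orbitMin_pertVar` (a box-`ℓ²`-orbit
  minimiser in both currencies at once).
* §2 ★★★ `exists_regauged_tower_of_massRows` — `P(i)` for every `i ≤ k`; ★★★ `exists_regauge_top_sum_normSq_le_of_massRows` — the top level
  (`≤ (2·ρ^k·X)²`, orbit-minimising), both modulo the displayed rows `hMass`, ROW-L, ROW-M (quantified over the levels `i < k`).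
HONEST SCOPE.  Induction bookkeeping over p688053 ∕ p683212 ∕ p686171's letters; the mass rows, ROW-L∕ROW-M and the guards are displayed; the reading sets,
the windows → `α_i`, the schedule `ms_i` and the `T3Family` packaging to hStab⋆'s letters on the annulus are the sequel (F6-KNIT); the mass rows' supplier
(F6-ROW) is the covariant mean-value road.  Nothing of [Balaban1985Averaging] is asserted beyond the cited tree theorems.

References: T. Bałaban, CMP 98 (1985) 17–51 [Balaban1985Averaging] (Prop. 3 (122)–(126) p.36, (11) p.19, §3 (156)–(163)); CMP 109 (1987) 249–301
[Balaban1987RG1] ((0.4), (0.11), (0.14) pp.253–254).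
-/

noncomputable section

open scoped BigOperators Matrix.Norms.L2Operator
open NormedSpace

namespace Summit.QuantumFields.YangMills.Theorems.PoincareLipschitzRegaugedTowerInductionMass

open Literature.MathematicalPhysics.QuantumFieldTheory.Balaban1983to89
open Finset T4Continuum BlockAveraging AveragingRT ExpMeanLog BlockAveragingEMLLinearised BlockAveragingEMLLinearisedBackground BlockAveragingEMLProp2
open Summit.QuantumFields.YangMills.Theorems.PoincareLipschitzRegaugedTowerStepMass (exists_regauge_sum_normSq_le_of_mass)
open Summit.QuantumFields.YangMills.Theorems.PoincareLipschitzRegaugedTowerInduction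
  (gaugeAct_mul_gaugeAct gaugeAct_const_one iter_succ_eq_avgFun add_mul_le_mul_exp)
open Summit.QuantumFields.YangMills.Theorems.PoincareLipschitzRegaugeAbsorption (dist1_mul_inv_eq_norm_pertVar)
open Summit.QuantumFields.YangMills.Theorems.PoincareLipschitzOrbitMinLevel (exists_orbitMinimiser_level)

variable {P : Params}

/-! ## §1 Currency and the re-minimisation letter -/

/-- **CURRENCY**: `Σ_{b∈S}‖pertVar V W b‖² = Σ_b 𝟙_S(b)·dist1(V_b·W_b⁻¹)²` (`dist1(W_bV_b⁻¹) = ‖pertVar V W b‖`, `dist1 g⁻¹ = dist1 g`). [folklore] -/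
theorem sum_normSq_pertVar_eq_boxDistSq {i : ℕ} (S : Finset (PBond P i))
    (V W : GaugeField P i (Matrix.specialUnitaryGroup (Fin 2) ℂ)) :
    ∑ b ∈ S, ‖pertVar V W b‖ ^ 2 = ∑ b : PBond P i, if b ∈ S then dist1 (V b * (W b)⁻¹) ^ 2 else 0 := by
  rw [Finset.sum_ite_mem, Finset.univ_inter]
  refine Finset.sum_congr rfl fun b _ => ?_
  rw [show V b * (W b)⁻¹ = (W b * (V b)⁻¹)⁻¹ by rw [mul_inv_rev, inv_inv], GaugeGroup.dist1_inv, dist1_mul_inv_eq_norm_pertVar]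

/-- ★ **A BOX-`ℓ²`-ORBIT MINIMISER AT LEVEL `i`, IN BOTH CURRENCIES**: for level-`i` `SU(2)` fields `V, W₀` and a finset `S` of level-`i` bonds there is a
gauge transformation `k₀` such that `W := W₀^{k₀}` is box-`ℓ²`-orbit-minimising on `S` w.r.t. `V` in the `dist1` currency of
✓`PoincareLipschitzOrbitMinLevel.reTr_oneSite_le_of_orbitMin_level` (`box := (· ∈ S)`), and `Σ_{b∈S}‖pertVar V W b‖² ≤ Σ_{b∈S}‖pertVar V (W₀^{k}) b‖²` for every `k`
(✓`exists_orbitMinimiser_level` + `(V^v)^u = V^{uv}` + the currency letter). [cite: Balaban1987RG1, (0.14) p.254] -/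
theorem exists_orbitMin_pertVar {i : ℕ} (S : Finset (PBond P i)) (V W₀ : GaugeField P i (Matrix.specialUnitaryGroup (Fin 2) ℂ)) :
    ∃ k₀ : GaugeTransf P i (Matrix.specialUnitaryGroup (Fin 2) ℂ),
      (∀ k' : GaugeTransf P i (Matrix.specialUnitaryGroup (Fin 2) ℂ),
        (∑ b : PBond P i, if b ∈ S then dist1 (V b * (GaugeField.gaugeAct k₀ W₀ b)⁻¹) ^ 2 else 0) ≤
          ∑ b : PBond P i, if b ∈ S then dist1 (V b * (GaugeField.gaugeAct k' (GaugeField.gaugeAct k₀ W₀) b)⁻¹) ^ 2 else 0) ∧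
      ∀ k : GaugeTransf P i (Matrix.specialUnitaryGroup (Fin 2) ℂ),
        ∑ b ∈ S, ‖pertVar V (GaugeField.gaugeAct k₀ W₀) b‖ ^ 2 ≤ ∑ b ∈ S, ‖pertVar V (GaugeField.gaugeAct k W₀) b‖ ^ 2 := by
  obtain ⟨k₀, hk₀⟩ := exists_orbitMinimiser_level (fun b => b ∈ S) V W₀
  refine ⟨k₀, fun k' => ?_, fun k => ?_⟩
  · rw [gaugeAct_mul_gaugeAct]
    exact hk₀ _
  · rw [sum_normSq_pertVar_eq_boxDistSq, sum_normSq_pertVar_eq_boxDistSq]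
    exact hk₀ k

/-! ## §2 The re-minimised tower -/

/-- ★★★ **THE RE-GAUGED, RE-MINIMISED NONLINEAR TOWER, EVERY LEVEL, WALK MASSES DISPLAYED.**  Data: level-0 `SU(2)` fields `U, U'`; bond sets `S_0, …, S_k`;
loop-size bounds `0 ≤ α_i ≤ 1/24` for the background tower `Ū^{(i)}U` on `S_{i+1}`; the `ℓ²` datum `Σ_{S_0}‖pertVar U U'‖² ≤ X²` (NO smallness of `X`);
`(L^d)⁻¹L² ≤ 1`; walk-mass levels `ms_i ≥ 0` with `72·ms_i ≤ 1`, `3·ms_i + α_i < δ₂` and `(κ/ρ)·Σ_{i<k}(159α_i + 520·ms_i) ≤ 1/2`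
(`ρ = √((L^d)⁻¹L²)`, `κ = (d+2)L·√((2dL^d)(2d))`); the displayed MASS ROW at every level `i < k` (orbit-minimising gauge copies of `Ū^iU'` with
`ℓ²(S_i)`-mass `≤ 2ρ^iX` have two-block walk masses `(d+2)L·Σ_{N(c)}‖·‖ ≤ ms_i` at every `c ∈ S_{i+1}`); and the box-local rows ROW-L∕ROW-M at every
level.  Then for every `i ≤ k` there is a level-`i` gauge transformation `h`, box-`ℓ²`-orbit-minimising on `S_i`, with
`Σ_{b∈S_i}‖pertVar (Ū^{(i)}U) ((Ū^{(i)}U')^h) b‖² ≤ (X·ρ^i·exp((κ/ρ)·Σ_{i'<i}(159α_{i'} + 520·ms_{i'})))²`.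
[cite: Balaban1985Averaging, Prop. 3 (122)-(126) p.36] -/
theorem exists_regauged_tower_of_massRows {k : ℕ} (hk : k ≤ P.m + P.K) (U U' : GaugeField P 0 (Matrix.specialUnitaryGroup (Fin 2) ℂ))
    (S : (i : ℕ) → Finset (PBond P i))
    (α : ℕ → ℝ) (hα0 : ∀ i, i < k → 0 ≤ α i) (hα24 : ∀ i, i < k → α i ≤ 1 / 24)
    (hα : ∀ i, i < k → ∀ c ∈ S (i + 1), ∀ idx : Idx P,
      dist1 (loopHol (Averaging.iter (fun i' => blockAvg (P := P) (j := i') (expMeanLogSU (n := Fin 2))) i U) c idx) ≤ α i)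
    {X : ℝ} (hX0 : 0 ≤ X) (hX : ∑ b ∈ S 0, ‖pertVar U U' b‖ ^ 2 ≤ X ^ 2)
    (hρ1 : ((P.L : ℝ) ^ P.d)⁻¹ * (P.L : ℝ) ^ 2 ≤ 1)
    (ms : ℕ → ℝ) (hms0 : ∀ i, i < k → 0 ≤ ms i) (hms72 : ∀ i, i < k → 72 * ms i ≤ 1)
    (hmsN : ∀ i, i < k → 3 * ms i + α i < deltaSU (Fin 2))
    (hsum : (((P.d + 2) * P.L : ℕ) : ℝ) * Real.sqrt (2 * P.d * (P.L : ℝ) ^ P.d * (2 * P.d)) / Real.sqrt (((P.L : ℝ) ^ P.d)⁻¹ * (P.L : ℝ) ^ 2)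
        * ∑ i ∈ Finset.range k, (159 * α i + 520 * ms i) ≤ 1 / 2)
    (hMass : ∀ i, i < k → ∀ h : GaugeTransf P i (Matrix.specialUnitaryGroup (Fin 2) ℂ),
      (∀ k' : GaugeTransf P i (Matrix.specialUnitaryGroup (Fin 2) ℂ),
        (∑ b : PBond P i, if b ∈ S i then
            dist1 (Averaging.iter (fun i' => blockAvg (P := P) (j := i') (expMeanLogSU (n := Fin 2))) i U b *
              (GaugeField.gaugeAct h (Averaging.iter (fun i' => blockAvg (P := P) (j := i') (expMeanLogSU (n := Fin 2))) i U') b)⁻¹) ^ 2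
          else 0) ≤
          ∑ b : PBond P i, if b ∈ S i then
            dist1 (Averaging.iter (fun i' => blockAvg (P := P) (j := i') (expMeanLogSU (n := Fin 2))) i U b *
              (GaugeField.gaugeAct k' (GaugeField.gaugeAct h
                (Averaging.iter (fun i' => blockAvg (P := P) (j := i') (expMeanLogSU (n := Fin 2))) i U')) b)⁻¹) ^ 2
          else 0) →
      ∑ b ∈ S i, ‖pertVar (Averaging.iter (fun i' => blockAvg (P := P) (j := i') (expMeanLogSU (n := Fin 2))) i U)
          (GaugeField.gaugeAct h (Averaging.iter (fun i' => blockAvg (P := P) (j := i') (expMeanLogSU (n := Fin 2))) i U')) b‖ ^ 2 ≤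
        (2 * Real.sqrt (((P.L : ℝ) ^ P.d)⁻¹ * (P.L : ℝ) ^ 2) ^ i * X) ^ 2 →
      ∀ c ∈ S (i + 1), (((P.d + 2) * P.L : ℕ) : ℝ) *
        ∑ b ∈ univ.filter (fun b : PBond P i => blockOf b.src = c.src ∨ blockOf b.src = c.tgt),
          ‖pertVar (Averaging.iter (fun i' => blockAvg (P := P) (j := i') (expMeanLogSU (n := Fin 2))) i U)
            (GaugeField.gaugeAct h (Averaging.iter (fun i' => blockAvg (P := P) (j := i') (expMeanLogSU (n := Fin 2))) i U')) b‖ ≤ ms i)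
    (hRowL : ∀ i, i < k → ∀ (V W : GaugeField P i (Matrix.specialUnitaryGroup (Fin 2) ℂ)),
      ∑ c ∈ S (i + 1), ‖((Fintype.card (Idx P) : ℂ))⁻¹ • ∑ idx : Idx P,
        ((holAt V (walk (emb c.src) (stairWord idx.2.1 (off idx.1))) : Matrix.specialUnitaryGroup (Fin 2) ℂ) : Matrix (Fin 2) (Fin 2) ℂ) *
          covWalkSum V (pertVar V W) (walk (walkEnd (emb c.src) (stairWord idx.2.1 (off idx.1))) (List.replicate P.L (c.dir, true))) *
        star ((holAt V (walk (emb c.src) (stairWord idx.2.1 (off idx.1))) : Matrix.specialUnitaryGroup (Fin 2) ℂ) : Matrix (Fin 2) (Fin 2) ℂ)‖ ^ 2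
      ≤ ((P.L : ℝ) ^ P.d)⁻¹ * (P.L : ℝ) ^ 2 * ∑ b ∈ S i, ‖pertVar V W b‖ ^ 2)
    (hRowM : ∀ i, i < k → ∀ g : PBond P i → ℝ, (∀ b, 0 ≤ g b) →
      ∑ c ∈ S (i + 1), ∑ b ∈ univ.filter (fun b : PBond P i => blockOf b.src = c.src ∨ blockOf b.src = c.tgt), g b ≤ 2 * P.d * ∑ b ∈ S i, g b) :
    ∀ i, i ≤ k → ∃ h : GaugeTransf P i (Matrix.specialUnitaryGroup (Fin 2) ℂ),
      (∀ k' : GaugeTransf P i (Matrix.specialUnitaryGroup (Fin 2) ℂ),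
        (∑ b : PBond P i, if b ∈ S i then
            dist1 (Averaging.iter (fun i' => blockAvg (P := P) (j := i') (expMeanLogSU (n := Fin 2))) i U b *
              (GaugeField.gaugeAct h (Averaging.iter (fun i' => blockAvg (P := P) (j := i') (expMeanLogSU (n := Fin 2))) i U') b)⁻¹) ^ 2
          else 0) ≤
          ∑ b : PBond P i, if b ∈ S i then
            dist1 (Averaging.iter (fun i' => blockAvg (P := P) (j := i') (expMeanLogSU (n := Fin 2))) i U b *
              (GaugeField.gaugeAct k' (GaugeField.gaugeAct h
                (Averaging.iter (fun i' => blockAvg (P := P) (j := i') (expMeanLogSU (n := Fin 2))) i U')) b)⁻¹) ^ 2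
          else 0) ∧
      ∑ b ∈ S i, ‖pertVar (Averaging.iter (fun i' => blockAvg (P := P) (j := i') (expMeanLogSU (n := Fin 2))) i U)
          (GaugeField.gaugeAct h (Averaging.iter (fun i' => blockAvg (P := P) (j := i') (expMeanLogSU (n := Fin 2))) i U')) b‖ ^ 2 ≤
        (X * Real.sqrt (((P.L : ℝ) ^ P.d)⁻¹ * (P.L : ℝ) ^ 2) ^ i *
          Real.exp ((((P.d + 2) * P.L : ℕ) : ℝ) * Real.sqrt (2 * P.d * (P.L : ℝ) ^ P.d * (2 * P.d)) / Real.sqrt (((P.L : ℝ) ^ P.d)⁻¹ * (P.L : ℝ) ^ 2)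
            * ∑ i' ∈ Finset.range i, (159 * α i' + 520 * ms i'))) ^ 2 := by
  -- letters
  set av := (fun i' => blockAvg (P := P) (j := i') (expMeanLogSU (n := Fin 2))) with hav
  set ℓ : ℝ := (((P.d + 2) * P.L : ℕ) : ℝ) with hℓ
  set ρ : ℝ := Real.sqrt (((P.L : ℝ) ^ P.d)⁻¹ * (P.L : ℝ) ^ 2) with hρ
  set κ : ℝ := ℓ * Real.sqrt (2 * P.d * (P.L : ℝ) ^ P.d * (2 * P.d)) with hκ
  set qb : ℕ → ℝ := fun i => 159 * α i + 520 * ms i with hqb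
  set E : ℕ → ℝ := fun i => Real.exp (κ / ρ * ∑ i' ∈ Finset.range i, qb i') with hE
  have hℓ0 : 0 ≤ ℓ := by positivity
  have hκ0 : 0 ≤ κ := by positivity
  have hLpos : (0 : ℝ) < (P.L : ℝ) := by exact_mod_cast P.L_pos
  have hρpos : 0 < ρ := Real.sqrt_pos.2 (by positivity)
  have hρle1 : ρ ≤ 1 := by rw [hρ]; exact Real.sqrt_le_one.mpr hρ1 |>.trans_eq' rfl
  have hqb0 : ∀ i, i < k → 0 ≤ qb i := fun i hi => by
    have := hα0 i hi; have := hms0 i hi; simp only [hqb]; positivity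
  -- the exponent never exceeds `1/2`, so `E i ≤ 2` for `i ≤ k`
  have hsum' : κ / ρ * ∑ i' ∈ Finset.range k, qb i' ≤ 1 / 2 := by
    simpa only [hκ, hρ, hqb, hℓ, mul_assoc] using hsum
  have hEle : ∀ i, i ≤ k → E i ≤ 2 := by
    intro i hi
    have exp_half_le_two : Real.exp (1 / 2) ≤ 2 := by
      have h := Real.exp_one_lt_d9
      have h2 : Real.exp (1 / 2) ^ 2 = Real.exp 1 := by rw [← Real.exp_nat_mul]; norm_num
      nlinarith [Real.exp_pos (1 / 2)]
    have hmono : ∑ i' ∈ Finset.range i, qb i' ≤ ∑ i' ∈ Finset.range k, qb i' :=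
      Finset.sum_le_sum_of_subset_of_nonneg (Finset.range_mono hi) fun i' hi' _ => hqb0 i' (Finset.mem_range.1 hi')
    have : κ / ρ * ∑ i' ∈ Finset.range i, qb i' ≤ 1 / 2 :=
      (mul_le_mul_of_nonneg_left hmono (div_nonneg hκ0 hρpos.le)).trans hsum'
    exact (Real.exp_le_exp.2 this).trans exp_half_le_two
  have hEpos : ∀ i, 0 < E i := fun i => Real.exp_pos _
  -- the induction
  intro i
  induction i with
  | zero =>
    intro _
    obtain ⟨k₀, hk₀min, hk₀le⟩ := exists_orbitMin_pertVar (S 0) U U'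
    refine ⟨k₀, hk₀min, ?_⟩
    have h1 := hk₀le (fun _ => 1)
    rw [gaugeAct_const_one] at h1
    simp only [Finset.range_zero, Finset.sum_empty, mul_zero, Real.exp_zero, pow_zero, mul_one]
    exact h1.trans hX
  | succ i ih =>
    intro hi1
    have hik : i < k := by omega
    obtain ⟨h, hmin, hh⟩ := ih (by omega)
    -- the datum of the step
    set V := Averaging.iter av i U with hVdef
    set W := GaugeField.gaugeAct h (Averaging.iter av i U') with hWdef
    set M : ℝ := X * ρ ^ i * E i with hMdef
    have hM0 : 0 ≤ M := by positivity
    have hρi0 : 0 ≤ ρ ^ i := pow_nonneg hρpos.le i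
    have hM2 : M ≤ 2 * ρ ^ i * X := by
      calc M = X * ρ ^ i * E i := rfl
        _ ≤ X * ρ ^ i * 2 := by nlinarith [hEle i (by omega), (hEpos i).le, mul_nonneg hX0 hρi0]
        _ = 2 * ρ ^ i * X := by ring
    have hMsq : ∑ b ∈ S i, ‖pertVar V W b‖ ^ 2 ≤ M ^ 2 := by
      simpa only [hMdef, hVdef, hWdef, hav, hE, hqb, hκ, hρ, hℓ, mul_assoc] using hh
    have hMsq2 : ∑ b ∈ S i, ‖pertVar V W b‖ ^ 2 ≤ (2 * ρ ^ i * X) ^ 2 := hMsq.trans (pow_le_pow_left₀ hM0 hM2 2)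
    -- the displayed mass row at `h`
    have hmass : ∀ c ∈ S (i + 1), ℓ *
        ∑ b ∈ univ.filter (fun b : PBond P i => blockOf b.src = c.src ∨ blockOf b.src = c.tgt), ‖pertVar V W b‖ ≤ ms i := by
      intro c hc
      have key := hMass i hik h (by simpa only [hVdef, hWdef, hav] using hmin) (by simpa only [hVdef, hWdef, hav, hρ] using hMsq2) c hc
      simpa only [hVdef, hWdef, hav, hℓ] using key
    -- the LEAD's level step with the walk mass displayed
    obtain ⟨g, hg⟩ := exists_regauge_sum_normSq_le_of_mass (Nat.succ_le_of_lt (Nat.lt_of_lt_of_le hik hk)) V W (S (i + 1)) (S i)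
      hM0 hMsq (hα0 i hik) (fun c hc idx => by simpa only [hVdef, hav] using hα i hik c hc idx) (hα24 i hik)
      (hms0 i hik) (by simpa only [hℓ] using hmass) (hms72 i hik) (hmsN i hik)
      (by simpa only [hVdef, hWdef] using hRowL i hik V W) (hRowM i hik)
    -- covariance: the re-gauged average is a gauge copy of `Ū^{(i+1)}U'`
    have hcov : avgFun (expMeanLogSU (n := Fin 2)) W =
        GaugeField.gaugeAct (fun y => h (emb y)) (Averaging.iter av (i + 1) U') := by
      rw [hWdef, avgFun_covariant (expMeanLogSU (n := Fin 2)) (Nat.succ_le_of_lt (Nat.lt_of_lt_of_le hik hk))]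
      rfl
    have hident : GaugeField.gaugeAct g (avgFun (expMeanLogSU (n := Fin 2)) W) =
        GaugeField.gaugeAct (fun y => g y * h (emb y)) (Averaging.iter av (i + 1) U') := by
      rw [hcov, gaugeAct_mul_gaugeAct]
    have hV' : avgFun (expMeanLogSU (n := Fin 2)) V = Averaging.iter av (i + 1) U := rfl
    rw [hident, hV'] at hg
    -- the bound `(ρ + κ·q_i)·M ≤ X ρ^{i+1} E_{i+1}`
    have hstep : (ρ + κ * (159 * α i + 520 * ms i)) * M ≤ X * ρ ^ (i + 1) * E (i + 1) := by
      have h2 : (ρ + κ * qb i) * M ≤ ρ * Real.exp (κ * qb i / ρ) * M := add_mul_le_mul_exp hρpos (mul_nonneg hκ0 (hqb0 i hik)) hM0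
      have h3 : ρ * Real.exp (κ * qb i / ρ) * M = X * ρ ^ (i + 1) * E (i + 1) := by
        simp only [hMdef, hE, Finset.sum_range_succ, mul_add, Real.exp_add, pow_succ]
        have : κ * qb i / ρ = κ / ρ * qb i := by ring
        rw [this]; ring
      exact h2.trans h3.le
    have hlhs0 : 0 ≤ (ρ + κ * (159 * α i + 520 * ms i)) * M := by
      have := hα0 i hik; have := hms0 i hik; positivity
    have hsq := pow_le_pow_left₀ hlhs0 hstep 2
    -- re-minimise at level `i + 1`
    obtain ⟨k₀, hk₀min, hk₀le⟩ := exists_orbitMin_pertVar (S (i + 1)) (Averaging.iter av (i + 1) U) (Averaging.iter av (i + 1) U')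
    refine ⟨k₀, hk₀min, ?_⟩
    have hle := hk₀le (fun y => g y * h (emb y))
    refine hle.trans (hg.trans ?_)
    simpa only [hMdef, hE, hqb, hκ, hρ, hℓ, mul_assoc] using hsq

/-- ★★★ **THE TOP LEVEL**: `∃ h : GaugeTransf P k SU(2)`, box-`ℓ²`-orbit-minimising on `S_k`, with
`Σ_{b∈S_k}‖pertVar (Ū^{(k)}U) ((Ū^{(k)}U')^h) b‖² ≤ (2·ρ^k·X)²` — modulo the displayed mass rows, ROW-L, ROW-M, and NO smallness of `X`.
[cite: Balaban1985Averaging, Prop. 3 (122)-(126) p.36] -/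
theorem exists_regauge_top_sum_normSq_le_of_massRows {k : ℕ} (hk : k ≤ P.m + P.K) (U U' : GaugeField P 0 (Matrix.specialUnitaryGroup (Fin 2) ℂ))
    (S : (i : ℕ) → Finset (PBond P i))
    (α : ℕ → ℝ) (hα0 : ∀ i, i < k → 0 ≤ α i) (hα24 : ∀ i, i < k → α i ≤ 1 / 24)
    (hα : ∀ i, i < k → ∀ c ∈ S (i + 1), ∀ idx : Idx P,
      dist1 (loopHol (Averaging.iter (fun i' => blockAvg (P := P) (j := i') (expMeanLogSU (n := Fin 2))) i U) c idx) ≤ α i)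
    {X : ℝ} (hX0 : 0 ≤ X) (hX : ∑ b ∈ S 0, ‖pertVar U U' b‖ ^ 2 ≤ X ^ 2)
    (hρ1 : ((P.L : ℝ) ^ P.d)⁻¹ * (P.L : ℝ) ^ 2 ≤ 1)
    (ms : ℕ → ℝ) (hms0 : ∀ i, i < k → 0 ≤ ms i) (hms72 : ∀ i, i < k → 72 * ms i ≤ 1)
    (hmsN : ∀ i, i < k → 3 * ms i + α i < deltaSU (Fin 2))
    (hsum : (((P.d + 2) * P.L : ℕ) : ℝ) * Real.sqrt (2 * P.d * (P.L : ℝ) ^ P.d * (2 * P.d)) / Real.sqrt (((P.L : ℝ) ^ P.d)⁻¹ * (P.L : ℝ) ^ 2)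
        * ∑ i ∈ Finset.range k, (159 * α i + 520 * ms i) ≤ 1 / 2)
    (hMass : ∀ i, i < k → ∀ h : GaugeTransf P i (Matrix.specialUnitaryGroup (Fin 2) ℂ),
      (∀ k' : GaugeTransf P i (Matrix.specialUnitaryGroup (Fin 2) ℂ),
        (∑ b : PBond P i, if b ∈ S i then
            dist1 (Averaging.iter (fun i' => blockAvg (P := P) (j := i') (expMeanLogSU (n := Fin 2))) i U b *
              (GaugeField.gaugeAct h (Averaging.iter (fun i' => blockAvg (P := P) (j := i') (expMeanLogSU (n := Fin 2))) i U') b)⁻¹) ^ 2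
          else 0) ≤
          ∑ b : PBond P i, if b ∈ S i then
            dist1 (Averaging.iter (fun i' => blockAvg (P := P) (j := i') (expMeanLogSU (n := Fin 2))) i U b *
              (GaugeField.gaugeAct k' (GaugeField.gaugeAct h
                (Averaging.iter (fun i' => blockAvg (P := P) (j := i') (expMeanLogSU (n := Fin 2))) i U')) b)⁻¹) ^ 2
          else 0) →
      ∑ b ∈ S i, ‖pertVar (Averaging.iter (fun i' => blockAvg (P := P) (j := i') (expMeanLogSU (n := Fin 2))) i U)
          (GaugeField.gaugeAct h (Averaging.iter (fun i' => blockAvg (P := P) (j := i') (expMeanLogSU (n := Fin 2))) i U')) b‖ ^ 2 ≤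
        (2 * Real.sqrt (((P.L : ℝ) ^ P.d)⁻¹ * (P.L : ℝ) ^ 2) ^ i * X) ^ 2 →
      ∀ c ∈ S (i + 1), (((P.d + 2) * P.L : ℕ) : ℝ) *
        ∑ b ∈ univ.filter (fun b : PBond P i => blockOf b.src = c.src ∨ blockOf b.src = c.tgt),
          ‖pertVar (Averaging.iter (fun i' => blockAvg (P := P) (j := i') (expMeanLogSU (n := Fin 2))) i U)
            (GaugeField.gaugeAct h (Averaging.iter (fun i' => blockAvg (P := P) (j := i') (expMeanLogSU (n := Fin 2))) i U')) b‖ ≤ ms i)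
    (hRowL : ∀ i, i < k → ∀ (V W : GaugeField P i (Matrix.specialUnitaryGroup (Fin 2) ℂ)),
      ∑ c ∈ S (i + 1), ‖((Fintype.card (Idx P) : ℂ))⁻¹ • ∑ idx : Idx P,
        ((holAt V (walk (emb c.src) (stairWord idx.2.1 (off idx.1))) : Matrix.specialUnitaryGroup (Fin 2) ℂ) : Matrix (Fin 2) (Fin 2) ℂ) *
          covWalkSum V (pertVar V W) (walk (walkEnd (emb c.src) (stairWord idx.2.1 (off idx.1))) (List.replicate P.L (c.dir, true))) *
        star ((holAt V (walk (emb c.src) (stairWord idx.2.1 (off idx.1))) : Matrix.specialUnitaryGroup (Fin 2) ℂ) : Matrix (Fin 2) (Fin 2) ℂ)‖ ^ 2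
      ≤ ((P.L : ℝ) ^ P.d)⁻¹ * (P.L : ℝ) ^ 2 * ∑ b ∈ S i, ‖pertVar V W b‖ ^ 2)
    (hRowM : ∀ i, i < k → ∀ g : PBond P i → ℝ, (∀ b, 0 ≤ g b) →
      ∑ c ∈ S (i + 1), ∑ b ∈ univ.filter (fun b : PBond P i => blockOf b.src = c.src ∨ blockOf b.src = c.tgt), g b ≤ 2 * P.d * ∑ b ∈ S i, g b) :
    ∃ h : GaugeTransf P k (Matrix.specialUnitaryGroup (Fin 2) ℂ),
      (∀ k' : GaugeTransf P k (Matrix.specialUnitaryGroup (Fin 2) ℂ),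
        (∑ b : PBond P k, if b ∈ S k then
            dist1 (Averaging.iter (fun i' => blockAvg (P := P) (j := i') (expMeanLogSU (n := Fin 2))) k U b *
              (GaugeField.gaugeAct h (Averaging.iter (fun i' => blockAvg (P := P) (j := i') (expMeanLogSU (n := Fin 2))) k U') b)⁻¹) ^ 2
          else 0) ≤
          ∑ b : PBond P k, if b ∈ S k then
            dist1 (Averaging.iter (fun i' => blockAvg (P := P) (j := i') (expMeanLogSU (n := Fin 2))) k U b *
              (GaugeField.gaugeAct k' (GaugeField.gaugeAct h
                (Averaging.iter (fun i' => blockAvg (P := P) (j := i') (expMeanLogSU (n := Fin 2))) k U')) b)⁻¹) ^ 2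
          else 0) ∧
      ∑ b ∈ S k, ‖pertVar (Averaging.iter (fun i' => blockAvg (P := P) (j := i') (expMeanLogSU (n := Fin 2))) k U)
          (GaugeField.gaugeAct h (Averaging.iter (fun i' => blockAvg (P := P) (j := i') (expMeanLogSU (n := Fin 2))) k U')) b‖ ^ 2 ≤
        (2 * Real.sqrt (((P.L : ℝ) ^ P.d)⁻¹ * (P.L : ℝ) ^ 2) ^ k * X) ^ 2 := by
  obtain ⟨h, hmin, hh⟩ := exists_regauged_tower_of_massRows hk U U' S α hα0 hα24 hα hX0 hX hρ1 ms hms0 hms72 hmsN hsum hMass hRowL hRowM k le_rfl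
  refine ⟨h, hmin, hh.trans (pow_le_pow_left₀ (by positivity) ?_ 2)⟩
  -- `X ρ^k E_k ≤ 2 ρ^k X`
  have hE : Real.exp ((((P.d + 2) * P.L : ℕ) : ℝ) * Real.sqrt (2 * P.d * (P.L : ℝ) ^ P.d * (2 * P.d)) / Real.sqrt (((P.L : ℝ) ^ P.d)⁻¹ * (P.L : ℝ) ^ 2)
            * ∑ i' ∈ Finset.range k, (159 * α i' + 520 * ms i')) ≤ 2 := by
    have exp_half_le_two : Real.exp (1 / 2) ≤ 2 := by
      have h := Real.exp_one_lt_d9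
      have h2 : Real.exp (1 / 2) ^ 2 = Real.exp 1 := by rw [← Real.exp_nat_mul]; norm_num
      nlinarith [Real.exp_pos (1 / 2)]
    exact (Real.exp_le_exp.2 hsum).trans exp_half_le_two
  have hρk : 0 ≤ Real.sqrt (((P.L : ℝ) ^ P.d)⁻¹ * (P.L : ℝ) ^ 2) ^ k := pow_nonneg (Real.sqrt_nonneg _) k
  nlinarith [mul_nonneg hX0 hρk, Real.exp_pos ((((P.d + 2) * P.L : ℕ) : ℝ) * Real.sqrt (2 * P.d * (P.L : ℝ) ^ P.d * (2 * P.d)) / Real.sqrt (((P.L : ℝ) ^ P.d)⁻¹ * (P.L : ℝ) ^ 2)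
            * ∑ i' ∈ Finset.range k, (159 * α i' + 520 * ms i'))]

end Summit.QuantumFields.YangMills.Theorems.PoincareLipschitzRegaugedTowerInductionMass

end
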